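import Summits.BirchSwinnertonDyer.BirchSwinnertonDyer.Theorems.ClassRecordThreeEulerHalvesAtThreeShimuraInertSavingDisplayOfE0Prime
import Summits.BirchSwinnertonDyer.BirchSwinnertonDyer.Theorems.ClassRecordThreeEulerHalvesAtThreeShimuraAuxNormE0Prime
import Summits.BirchSwinnertonDyer.BirchSwinnertonDyer.Theorems.ClassRecordThreeEulerHalvesAtThreeCarrierLocalE0AtThree
import Summits.BirchSwinnertonDyer.BirchSwinnertonDyer.Theorems.ClassRecordThreeEulerHalvesAtThreeAuxInertLevelAtThree
import Summits.BirchSwinnertonDyer.BirchSwinnertonDyer.Theorems.ClassRecordThreeCornerAtThreeMilneTamagawaHolds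
import Summits.BirchSwinnertonDyer.BirchSwinnertonDyer.Theorems.ClassRecordThreeEulerHalvesAtThreePoitouTateOfCanonical
import Summits.BirchSwinnertonDyer.BirchSwinnertonDyer.Theorems.SchneiderFreeAdditiveX3PoitouTateReciprocitySumHolds
import Summits.BirchSwinnertonDyer.BirchSwinnertonDyer.Theorems.ClassRecordThreeEulerHalvesAtThreeCartanOrderMachineUnramified
import Summits.BirchSwinnertonDyer.BirchSwinnertonDyer.Theorems.ClassRecordThreeShimuraKolyvaginImageInputs
import Summits.BirchSwinnertonDyer.BirchSwinnertonDyer.Theorems.ClassRecordThreeEulerHalvesAtThreeResidualUpperBoundCartanDivKummerPlaces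
import Summits.BirchSwinnertonDyer.BirchSwinnertonDyer.Theorems.RamifiedHeegnerPairLeafShimuraSavedDisplaySplitPortTargets
import HarnessLib

/-!
# Crux 23422 `EulerHalvesAtThreeResidualUpperBound`, line `cartan`: the stub (DIV_C) `stub_cartanDivAtThree` PROVED — the label-side global
# divisibility of the derived CM points on a CARTAN frame (assembly)

Seat `bsd-stepL-tam3-p1` (g20), LINE OWNER of crux 23422 (`--supports stmt-BirchSwinnertonDyer-23422 --as helper`). The registered stub
`stub_cartanDivAtThree` of `Cruxes/EulerHalvesAtThreeResidualUpperBound/Lines/cartan.lean` v6′ — the `hDivLab` input (at `t := s`) of bsd-idea-10 g9's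
PROVED unramified ORDER machine `ShimuraKolyvaginOfImage.cartanOrderMachineAtThree` — VERBATIM, PROVED: for `V` in X11b@3 with `Surj V 3`, a Cartan
frame (`K` imaginary quadratic, `d_K < −4`, an even set `S` of inert multiplicative places, a set `C` of inert-unramified Cartan places `q ≠ 3`,
`q² ∥ N`, `3 ∣ c_q`, every other bad prime split) and EVERY labelled CM family (`ShimuraWalk.LabelsAt`), at every prime `q ∉ S ∪ C` and depth
`s ≤ ord₃ c_q(V)`, the level-`3^M` Kolyvagin point of every admissible conductor is divisible by `3^s` modulo `3^M`.

PROOF = the Eichler-locus derivation of 19109's line `inert` (tam3-p1 g18 `ShimuraWalk.inertSavingDisplayAtThreeD_of_primitives_of_E0Prime…`, §2)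
run on the frame `T := S ∪ C`: bsd-jet's abstract §6 END `JET.Section6.depth_le_mdiv_of_swap_of_perLevel` on the swap ∕ per-level supplies, which
are er5-w3's generic port targets re-keyed to «`p ∤ d_K`» by bsd-line-rhp-p2 g11 (`…RamifiedHeegnerPairLeafShimuraSavedDisplaySplitPortTargets`:
`swapSupplyAt_of_poitouTate_of_hceb_of_hSel_of_not_dvd_discr`, `shimuraLevelSupplyAt_of_poitouTate_ofImage_of_producers_of_not_dvd_discr`, read at the guard set `T`) fed by: the Kummer producer of
port 1/4 (`…CartanDivKummerPlaces`: Gross 6.2 (1) with the Cartan places served by COMPLETE SPLITTING of `q𝓞_K` in `K[m]`, no receptacle there);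
the E′-labels at the carriers OFF `T` (tam3-p1 g18's `carrierLabelsE0Prime_of_galTrivial_of_kills_of_auxLevel` over `CarrierLocalE0.stub_carrierLocalE0AtThree`
and `AuxInertLevel.stub_auxiliaryInertLevelAtThree`, read with `S ↦ T`); Jetchev 4.9 at the exempted split carrier
(`localization_kolyvaginClass_familyData_mem_stringentFamily_of_labelE0Prime_singleton`, `S ↦ T`); the four mod-`3` image inputs on the UNRAMIFIED
locus (bsd-idea-10 g9's `kolyvaginImageInputs_three_of_unramified`) for the Čebotarev supply (`Koly.hceb_family_ofImage`); Milne I.3.8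
(`MilneTamagawa.…_holds`) and Poitou–Tate (`Koly.poitouTate_conj_forall_of_selmerComplement_canonical` over x3's canonical complement) — all TREE
THEOREMS. So the line's (DIV_C) port obligation is discharged: with it, T2 and the three asides, `Lines/cartan.lean` v6′ has ONE registered stub left,
the Cartan degree law (F2). HONEST FRAMING: theorems only (no definition, no named fact, no `sorry`); CONDITIONAL on nothing but its displayed
binders; nothing is asserted about any particular curve; no census label moves (T7); item 23422 is NOT closed by this file; BSD is proved for no curve.
-- §2 glue adapted from Summits/BirchSwinnertonDyer/BirchSwinnertonDyer/Theorems/ClassRecordThreeEulerHalvesAtThreeShimuraInertSavingDisplayOfE0Prime.lean §2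
References (locators only): [cite: Jetchev2008, Thm. 1.1, Thm. 1.4 (p. 812), Thm. 6.3, Prop. 6.4, Prop. 4.9] [cite: McCallumLMS1991, §5 Prop. 5.2, Cor. 5.6]
[cite: GrossLMS1991, §3 (3.2), Prop. 5.4, §6 Prop. 6.2 (1), p. 245, §9 Prop. 9.3] [cite: MilneADT2006, Ch. I Prop. 3.8, Thm. 4.10]
[cite: KohenPacetti2016, §3 p. 14 (Cartan–Heegner hypothesis)] [cite: Kim2022HigherGZ, Rem. 7.9]. presearch: n/a (port of tree theorems).
Axioms: `propext`, `Classical.choice`, `Quot.sound`.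
-/

set_option autoImplicit false
set_option linter.dupNamespace false

noncomputable section

open scoped Classical NumberField Pointwise AddSubgroup

namespace Summit.BirchSwinnertonDyer.BirchSwinnertonDyer.Theorems.CartanDiv

open WeierstrassCurve IsDedekindDomain NumberField Field Function Literature.NumberTheory.EllipticCurves
  Literature.NumberTheory.EllipticCurves.ModularForms Literature.NumberTheory.EllipticCurves.Jetchev2008
  Literature.NumberTheory.EllipticCurves.KolyvaginCocycle
  Literature.NumberTheory.EllipticCurves.Rank1Residual Literature.NumberTheory.GaloisRepresentations
  Literature.NumberTheory.GaloisCohomology Literature.NumberTheory.Automorphic CongruenceSubgroup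
  Summit.BirchSwinnertonDyer.Rank1Residual.JET Summit.BirchSwinnertonDyer.Rank1Residual.JET.SelmerVocabulary
  Summit.BirchSwinnertonDyer.Rank1Residual.JET.Walk Summit.BirchSwinnertonDyer.Rank1Residual.JET.GlobalDuality
  Summit.BirchSwinnertonDyer.Rank1Residual Summit.BirchSwinnertonDyer.Rank1Residual.X11b
  Summit.BirchSwinnertonDyer.Rank1Residual.X11b.Three Summit.BirchSwinnertonDyer.Rank1Residual.X11b.Three.Koly
  Summit.BirchSwinnertonDyer.BirchSwinnertonDyer.Theorems Summit.BirchSwinnertonDyer.BirchSwinnertonDyer.Theorems.ShimuraWalk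
  Literature.NumberTheory.EllipticCurves.ShimuraCMFamily
  Literature.NumberTheory.EllipticCurves.RingClassField Literature.NumberTheory.EllipticCurves.KolyvaginEuler
  Literature.NumberTheory.EllipticCurves.KolyvaginDescent

set_option maxHeartbeats 1600000 in
/-- **(DIV_C) `stub_cartanDivAtThree` of line `cartan` (crux 23422), VERBATIM, PROVED** — see the module docstring. The Jetchev walk of 19109's
line `inert` run on the inert-unramified frame `T := S ∪ C`: swap ∕ per-level supplies (rhp-p2 g11 `_of_not_dvd_discr`) over the Cartan-frame Kummer producer (p673873),
the E′-labels at the carriers off `T`, Jetchev 4.9 at the exempted carrier, the mod-`3` image inputs on the unramified locus, Milne I.3.8 and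
Poitou–Tate; then bsd-jet's §6 END. [cite: Jetchev2008, Thm. 1.4 (p. 812), Thm. 6.3, Prop. 6.4] [cite: McCallumLMS1991, §5 Prop. 5.2]
[cite: GrossLMS1991, §6 Prop. 6.2 (1), p. 245] [cite: MilneADT2006, Ch. I Prop. 3.8] -/
theorem cartanDivAtThree :
    ∀ (V : WeierstrassCurve ℚ) [V.IsElliptic] [V.IsGloballyMinimal], ClassX11b V 3 → Surj V 3 →
      ∀ (N : ℕ) [NeZero N] (K : Type) [Field K] [NumberField K] (S C : Finset ℕ)
        (Dt : ModularParametrizationData V N),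
        V.conductorNorm ℤ = N → ∀ (hK : IsImaginaryQuadratic K), NumberField.discr K < -4 → Even S.card →
        (∀ ℓ ∈ S, ℓ.Prime ∧ ℓ ∣ N ∧ ¬ ℓ ^ 2 ∣ N ∧
          ((Ideal.span {(ℓ : ℤ)}).primesOver (𝓞 K)).ncard = 1 ∧ ¬ (ℓ : ℤ) ∣ NumberField.discr K) →
        (∀ q ∈ C, ∃ _ : Fact q.Prime, q ≠ 3 ∧ q ^ 2 ∣ N ∧ ¬ q ^ 3 ∣ N ∧
          3 ∣ (V.baseChange ℚ_[q]).localTamagawaNumber ℤ_[q] ∧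
          ((Ideal.span {(q : ℤ)}).primesOver (𝓞 K)).ncard = 1 ∧ ¬ (q : ℤ) ∣ NumberField.discr K) →
        (∀ ℓ : ℕ, ℓ.Prime → ℓ ∣ N → ℓ ∉ S → ℓ ∉ C → ((Ideal.span {(ℓ : ℤ)}).primesOver (𝓞 K)).ncard = 2) →
        ¬ (3 : ℤ) ∣ Dt.c →
        ∀ (ι : K →+* ℂ) (y : (V.baseChange K).toAffine.Point)
          (ys : (m : ℕ) → (V.baseChange (ringClassField K ι m)).toAffine.Point) (ε : ℤ),
          ShimuraWalk.LabelsAt V N K ι y ys ε →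
          ∀ (q : ℕ) [Fact q.Prime] (s : ℕ), q ∉ S → q ∉ C →
            s ≤ padicValNat 3 ((V.baseChange ℚ_[q]).localTamagawaNumber ℤ_[q]) →
            ∀ (k M k' : ℕ), Squarefree k' →
              (∀ q' ∈ k'.primeFactors, IsKolyvaginPrime N V K 3 q' ∧ FrobEqFrobInfty V K (3 ^ (M + k)) q') →
              letI : CommGroup (ringClassGal ι k') := { (inferInstance : Group (ringClassGal ι k')) with
                mul_comm := fun a b ↦ (KolyvaginH44.isMulCommutative_ringClassGal' hK ι k').is_comm.comm a b }
              letI : DistribMulAction (ringClassGal ι k') ((V.baseChange (ringClassField K ι k')).toAffine.Point) :=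
                DistribMulAction.compHom _ ((pointGalHom V (ringClassField K ι k')).comp (ringClassGal ι k').subtype)
              ∀ (σ' : ℕ → ringClassGal ι k') (H' : Subgroup (ringClassGal ι k')) [Fintype (ringClassGal ι k' ⧸ H')]
                (f' : ringClassGal ι k' ⧸ H' → ringClassGal ι k'),
                (∀ q' ∈ k'.primeFactors, σ' q' ^ (q' + 1) = 1) →
                (∀ q' ∈ k'.primeFactors, Subgroup.zpowers (σ' q' : ringClassField K ι k' ≃ₐ[ℚ] ringClassField K ι k') =
                  ringClassGalOver ι k' (k' / q')) →
                (∀ c, (f' c : ringClassGal ι k' ⧸ H') = c) →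
                (∀ h ∈ H', (h : ringClassField K ι k' ≃ₐ[ℚ] ringClassField K ι k') ∈ ringClassGalOver ι k' 1) →
                ∃ B : (V.baseChange (ringClassField K ι k')).toAffine.Point,
                  ((3 ^ M : ℕ) : ℤ) • B = ((3 : ℤ) ^ (M - s)) • kolyvaginPoint σ' k'.primeFactors f' (ys k') := by
  intro V _ _ hX hsurj N _ K _ _ S C Dt hN hK hD hSe hin hC hsp hc ι y ys ε hL q _ s hqS hqC hs
  haveI h3F : Fact (Nat.Prime 3) := ⟨Nat.prime_three⟩
  haveI : ∀ j : ℕ, NumberField (ringClassField K ι j) := numberField_ringClassField K hK ι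
  have hp : (3 : ℕ).Prime := Nat.prime_three
  have hp2 : (3 : ℕ) ≠ 2 := by decide
  have hirr : V.HasIrreducibleModPGaloisRep 3 := hX.2.2.2
  -- the inert-unramified set `T := S ∪ C` and the frame clauses on it
  set T : Finset ℕ := S ∪ C with hT
  have hinT : ∀ ℓ ∈ T, ℓ.Prime ∧ ℓ ∣ N ∧
      ((Ideal.span {(ℓ : ℤ)}).primesOver (𝓞 K)).ncard = 1 ∧ ¬ (ℓ : ℤ) ∣ NumberField.discr K := by
    intro ℓ hℓ
    rcases Finset.mem_union.mp hℓ with h | h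
    · exact ⟨(hin ℓ h).1, (hin ℓ h).2.1, (hin ℓ h).2.2.2.1, (hin ℓ h).2.2.2.2⟩
    · obtain ⟨hF, -, h2, -, -, hn1, hd⟩ := hC ℓ h
      exact ⟨hF.out, (dvd_pow_self ℓ two_ne_zero).trans h2, hn1, hd⟩
  have hspT : ∀ ℓ : ℕ, ℓ.Prime → ℓ ∣ N → ℓ ∉ T → ((Ideal.span {(ℓ : ℤ)}).primesOver (𝓞 K)).ncard = 2 :=
    fun ℓ hℓ hℓN hℓT ↦ hsp ℓ hℓ hℓN (fun h ↦ hℓT (Finset.mem_union_left C h)) (fun h ↦ hℓT (Finset.mem_union_right S h))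
  have hqT : q ∉ T := fun h ↦ (Finset.mem_union.mp h).elim hqS hqC
  -- `3 ∣ N`: `V` is multiplicative at `3` (X11b)
  have h3N : 3 ∣ N := by
    have h := (V.dvd_conductorNorm_iff_not_hasGoodReductionAtPrime 3).mpr
      (not_hasGoodReductionAtPrime_of_hasMultiplicativeReductionAtPrime 3 hX.2.2.1)
    rwa [hN] at h
  -- every prime of `N` is unramified in `K`; in particular `3`
  have hunrN : ∀ ℓ : ℕ, ℓ.Prime → ℓ ∣ N → ¬ (ℓ : ℤ) ∣ NumberField.discr K := by
    intro ℓ hℓ hℓN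
    by_cases hℓT : ℓ ∈ T
    · exact (hinT ℓ hℓT).2.2.2
    · exact ShimuraKolyvaginImageInputs.not_dvd_discr_of_ncard_primesOver_eq_two K hK.1 hℓ (hspT ℓ hℓ hℓN hℓT)
  have h3d : ¬ ((3 : ℕ) : ℤ) ∣ NumberField.discr K := hunrN 3 hp h3N
  -- tree inputs: Milne I.3.8 and Poitou–Tate for Selmer structures
  have hM : Milne2006_localTamagawaNumber_smul_unramifiedClass_eq_zero.{0} :=
    MilneTamagawa.Milne2006_localTamagawaNumber_smul_unramifiedClass_eq_zero_holds
  have hPT : ∀ (K : Type) [Field K] [NumberField K], poitouTate_selmerStructure_duality_conj K :=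
    poitouTate_conj_forall_of_selmerComplement_canonical fun K _ _ n _ ↦
      SchneiderFreeAdditiveX3.PoitouTateReduction.selmerComplement_canonical_holds K n
  -- the four mod-`3` image inputs on the UNRAMIFIED locus (bsd-idea-10 g9)
  obtain ⟨hIz, hIs, hIc, hIt⟩ :=
    ShimuraKolyvaginOfImage.kolyvaginImageInputs_three_of_unramified K V hN hirr hK hunrN h3d
  -- admissibility of `E(K[n])` for every datum (`E[3]` irreducible, `3` unramified in `K`)
  have hKunr := ShimuraKolyvaginOfImage.isUnramifiedIn_rat_of_not_dvd_discr K hp h3d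
  have hW3 := WeierstrassCurve.exists_weilPairing_holds V 3
  have hA : ∀ (n : ℕ) (d : KolyvaginFamilyData V K ι n), d.y = ys n → Squarefree n →
      (∀ q' ∈ n.primeFactors, IsKolyvaginPrime N V K 3 q') →
      ∀ j : ℕ, IsAdmissible (absoluteGaloisGroup K) d.pointsSubgroup ((3 ^ j : ℕ) : ℤ) := by
    subst hN
    exact fun n d _ hn hKP j ↦ d.isAdmissible_pointsSubgroup_family_of_hasIrreducibleModPGaloisRep hK hn.ne_zero hp hp2
      hirr hW3 hKunr (fun h3n ↦ (hKP 3 (Nat.mem_primeFactors.mpr ⟨hp, h3n, hn.ne_zero⟩)).2.2.2.1 rfl) j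
  -- the E′-labels at the carriers OFF `T` (auxiliary-norm road; the carriers off `T` split in `K`)
  have hE0T := carrierLabelsE0Prime_of_galTrivial_of_kills_of_auxLevel V ι hK (p := 3) (N := N) (S := T)
    (fun q' _ hq'N hq'T h3 ↦ (CarrierLocalE0.stub_carrierLocalE0AtThree V K ι hK q' h3 (hspT q' Fact.out hq'N hq'T)).1)
    (fun q' _ hq'N hq'T h3 ↦ (CarrierLocalE0.stub_carrierLocalE0AtThree V K ι hK q' h3 (hspT q' Fact.out hq'N hq'T)).2)
    (fun q' _ hq'N hq'T _ ↦ AuxInertLevel.stub_auxiliaryInertLevelAtThree V K ι hK hD hsurj q' N (hspT q' Fact.out hq'N hq'T)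
      (NeZero.ne N)) ys hL
  -- Milne I.3.8 at the curve `V/K`
  have hM38 : ∀ (v : HeightOneSpectrum (𝓞 K)) {𝔐 : Ideal (v.localAbsIntegers)}, 𝔐 ∈ v.localPrimesAbove →
      ∀ f : contOneCocycles (discreteTopRep (absoluteGaloisGroup (v.adicCompletion K))
          (localPoints (V.baseChange K) (v.adicCompletion K))),
        (∀ σ ∈ 𝔐.inertia (absoluteGaloisGroup (v.adicCompletion K)), f.1 σ = 0) →
        (((V.baseChange K).baseChange (v.adicCompletion K)).localTamagawaNumber (v.adicCompletionIntegers K) : ℤ) •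
          oneCocycleClass (discreteTopRep (absoluteGaloisGroup (v.adicCompletion K))
            (localPoints (V.baseChange K) (v.adicCompletion K))) f = 0 :=
    fun v _ h𝔐 f hf ↦ hM (V.baseChange K) v h𝔐 f hf
  -- the Kummer producer on the Cartan frame (port 1/4) and the Čebotarev supply from the image inputs
  have hSel : ∀ (M n : ℕ) (d : KolyvaginFamilyData V K ι n), 1 ≤ M → d.y = ys n → Squarefree n →
      (∀ q' ∈ n.primeFactors, IsKolyvaginPrime N V K 3 q' ∧ FrobEqFrobInfty V K (3 ^ M) q') →
      ∀ 𝔳 : HeightOneSpectrum (𝓞 K), (n : 𝓞 K) ∉ 𝔳.asIdeal →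
        d.kolyvaginClass hp M ∈ selmerLocalKer (V.baseChange K) (𝔳.adicCompletion K) ((3 ^ M : ℕ) : ℤ) :=
    fun M n d hMn hdy hn hKol 𝔳 h𝔳 ↦
      kolyvaginClass_familyData_mem_selmerLocalKer_of_labelsAt_of_tamagawa_of_E0Prime_inertUnram hK ι hN Dt hinT hspT ys hL
        hE0T hM38 hA M n d hMn hdy hn hKol 𝔳 h𝔳
  have hceb := hceb_family_ofImage V (N := N) hK hp2 hIz hIs hIc hIt
  -- the swap supply and the per-level supply at `q` (rhp-p2 g11's `_of_not_dvd_discr` port targets at the guard set `T`)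
  have hswap : SwapSupplyAt hK ι V N 3 ys :=
    swapSupplyAt_of_poitouTate_of_hceb_of_hSel_of_not_dvd_discr hPT V N K Dt hN hp2 hirr hK hD h3d ι y ys ε hL hSel hceb
  have hlv : LevelSupplyAt hK ι V N 3 ys (padicValNat 3 ((V.baseChange ℚ_[q]).localTamagawaNumber ℤ_[q])) :=
    shimuraLevelSupplyAt_of_poitouTate_ofImage_of_producers_of_not_dvd_discr hPT V N K T Dt hN hp2 hirr hK hD hspT h3d ι y ys ε hL
      hSel
      (fun q' _ hq'N hq'T htam k hn' n d hk hdy hn hKol v hqv hbad ↦ by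
        obtain ⟨n', hpn', hE0q⟩ := hE0T q' hq'N hq'T htam
        exact localization_kolyvaginClass_familyData_mem_stringentFamily_of_labelE0Prime_singleton hK ι Dt hspT ys hL q' hq'N hq'T
          hpn' (fun m hm hg w hw ↦ hE0q m hm hg w hw) hA k hn' n d hk hdy hn hKol v hqv hbad)
      hIz hIs hIc hIt q hqT
  -- bsd-jet's abstract §6 END at `Λ := Conductor V K N 3` (the glue of 19109's inert display, verbatim)
  intro k M k' hk' hKol σ' H' instF f' h1 h2 h3 h4
  set t : ℕ := padicValNat 3 ((V.baseChange ℚ_[q]).localTamagawaNumber ℤ_[q]) with ht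
  have hKol' : ∀ q' ∈ k'.primeFactors, IsKolyvaginPrime N V K 3 q' := fun q' hq' ↦ (hKol q' hq').1
  let c : Conductor V K N 3 := ⟨k', hk', hKol'⟩
  have key : ∀ s' : ℕ, s' ≤ t → s' ≤ M + k → PDiv hK ι V ys 3 k' s' := by
    intro s' hs't hs'Mk
    have hidx : (s' : ℕ∞) ≤ frobLevelIndex V K 3 k' :=
      (natCast_le_frobLevelIndex_iff hKol' s').mpr fun q' hq' ↦ (hKol q' hq').2.of_dvd (pow_dvd_pow 3 hs'Mk)
    have h := JET.Section6.depth_le_mdiv_of_swap_of_perLevel (Λ := Conductor V K N 3)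
      (fun c ↦ frobLevelIndex V K 3 c.1) (fun c ↦ mdiv hK ι V ys 3 c.1) t hswap hlv s' hs't c hidx
    exact (natCast_le_mdiv_iff hK ι V ys 3 k' s').mp h
  by_cases hsM : s ≤ M
  · obtain ⟨B₀, hB₀⟩ := key s hs (hsM.trans (Nat.le_add_right M k)) σ' H' f' h1 h2 h3 h4
    refine ⟨B₀, Eq.trans ?_ (congrArg (fun x ↦ ((3 : ℤ) ^ (M - s)) • x) hB₀)⟩
    show ((3 ^ M : ℕ) : ℤ) • B₀ = ((3 : ℤ) ^ (M - s)) • (((3 ^ s : ℕ) : ℤ) • B₀)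
    rw [smul_smul]
    congr 1
    push_cast
    rw [← pow_add, Nat.sub_add_cancel hsM]
  · push Not at hsM
    obtain ⟨B₀, hB₀⟩ := key M (hsM.le.trans hs) (Nat.le_add_right M k) σ' H' f' h1 h2 h3 h4
    refine ⟨B₀, hB₀.trans ?_⟩
    rw [Nat.sub_eq_zero_of_le hsM.le, pow_zero, one_smul]

end Summit.BirchSwinnertonDyer.BirchSwinnertonDyer.Theorems.CartanDiv

end
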